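import Literature.MathematicalPhysics.QuantumFieldTheory.BalabanImbrieJaffe1984to88.BIJ88ChiTDeriv309
import Literature.Analysis.Calculus.IteratedDerivCompBound

/-!
# `BalabanImbrieJaffe1984to88.BIJ88ChiTDerivN309` — T. Bałaban, J. Imbrie, A. Jaffe, *Effective action and cluster properties of the
abelian Higgs model*, Commun. Math. Phys. **114** (1988) 257–315 [BalabanImbrieJaffe1988]: the **n-th t-derivative of an
interpolated χ-factor**, p. 309 [PDF 53] (Sect. 5.14, the decoupling expansion).  After the displayed first-derivative identity
(kernel-checked in `BIJ88ChiTDeriv309`, p36 gen 4) the paper continues, verbatim: *"and similarly the n-th derivative in t of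
χ(cp(e_k), A^{(k)}) [sic: χ(cp(te_k), A^{(k)})] is bounded by t^{−n} times a function bounded by a constant and supported in
c₁p(te_k) ≤ |A^{(k)}| ≤ c₂p(te_k)."*  This file PROVES that sentence as real analysis ON THE CELL'S OBJECTS — the cutoff
(5.2.3)/(5.2.4) `BIJ88Sect5Statements.CutoffProfile` / `cutoff` (χ(p,x) = χ(1,x/p), χ(1,·) C^∞ with all derivatives bounded
(`deriv_bound`), = 1 on |x| ≤ 9/10, = 0 on |x| ≥ 1; r16) and the logarithmic scale (2.33) `BIJ88Sect2Statements.pLog`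
(p(e) = |log e⁻¹|^p; r18) — by the route the word *"similarly"* points to: the Faà di Bruno bound for the composite
`t ↦ χ(1, A/(c·p(te_k)))` (the tree's `Literature.Analysis.Calculus.norm_iteratedDeriv_comp_le_of_contDiffOn`, Mathlib's
`norm_iteratedFDerivWithin_comp_le`), fed with
* the uniform bounds on the derivatives of χ(1,·) of (5.2.3), and
* the structure of the t-derivatives of the inner function: `(d/dt)^i (−log(te_k))^{−p} = t^{−i} Σ_m a_m (−log(te_k))^{−p−j_m}`, a finite
  sum with coefficients depending on `p`, `i` only (`iteratedDeriv_negLogRpow`), whence `|(d/dt)^i [A/(c·p(te_k))]| ≤ M_i t^{−i}·|A/(c·p(te_k))|`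
  for `te_k ≤ e^{−1}` — and `|A/(c·p(te_k))| ≤ 1` wherever a derivative of χ(1,·) can be non-zero.

statement-level skeleton of published theorems with citation tags; proofs where landed; nothing here is a claim about the Yang–Mills mass gap

PDF held: `paper:balaban1988-cmp114-bij-abelian-higgs-effective-action` (journal page = PDF page + 256).  Page read as image: PDF p. 53
(journal 309), `g4png.py` ×2 render (seat folder `renders/original-p053-x2.png`).

CITATION HEADER (lean-in-tree rule).  Part of the lit-balaban TYPED SKELETON (HOME `run/shared/lean/pub/lit-balaban/`), Phase 2,
seat p36 (gen 5, unit `lit-balaban-p36`); row **C2.Eq5.14.3-5.14.4** of `HOME/lit-balaban-r16/ROWS-C2-part2.md` (typed leaf (5.14.4)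
`BIJ88Sect5StatementsPart2.Ineq5144`; this file kernel-checks the n-th-derivative sentence of its proof sketch, the member listed under
"NOT here" in `BIJ88ChiTDeriv309`).  WHAT IS REPRODUCED (theorem-only; no definitions, no `Prop` facts; axioms standard), for `0 < t`,
`0 < e_k`, `t·e_k ≤ e^{−1}` (so that `log(1/(te_k)) ≥ 1`), `c ≠ 0`, real `A`, every order `n`:
* `iteratedDeriv_negLogRpow` / `exists_bound_iteratedDeriv_negLogRpow`: the inner structure and **`|(d/dt)^i (−log(te_k))^{−p}| ≤
  M_i(p)·t^{−i}·(−log(te_k))^{−p}`**;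
* `abs_iteratedDeriv_inner_le`: **`|(d/dt)^i [A/(c·p(te_k))]| ≤ M_i(p)·t^{−i}·|A/(c·p(te_k))|`**;
* **`exists_abs_iteratedDeriv_cutoff_t_le`**: `∃ C = C(χ,p,n) ≥ 0`, for all `A, c, e_k, t` as above,
  **`|(d/dt)^n χ(c·p(te_k), A)| ≤ C·t^{−n}`**;
* **`support_iteratedDeriv_cutoff_t`** (`n ≥ 1`): the n-th derivative vanishes unless `(9/10)|c|·p(te_k) ≤ |A| ≤ |c|·p(te_k)` (the printed
  `c₁p(te_k) ≤ |A^{(k)}| ≤ c₂p(te_k)` with `c₁ = 9c/10`, `c₂ = c`, as for the first derivative);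
* **`exists_abs_iteratedDeriv_cutoff_t_le_indicator`** (`n ≥ 1`): the printed sentence in one line —
  `|(d/dt)^n χ(c·p(te_k), A)| ≤ t^{−n} · C · 𝟙{(9/10)|c|p(te_k) ≤ |A| ≤ |c|p(te_k)}`.
NOT here: the Gaussian-integration consequence *"ct^{−n}e^{−cp(te_k)²} ≤ (e^β(L^kε/ε₀)^{1/4−α})ⁿ"* (its arithmetic is `BIJ88GaussFactor309`),
(5.14.3)–(5.14.4) themselves.
-/

namespace Literature.MathematicalPhysics.QuantumFieldTheory.BalabanImbrieJaffe1984to88.BIJ88ChiTDerivN309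

open BIJ88Sect2Statements (pLog)
open BIJ88Sect5Statements (CutoffProfile cutoff)
open BIJ88ChiTDeriv309 (pLog_eq_rpow_neg_log)
open scoped Nat Topology

/-! ## §1 The inner function: t-derivatives of `(−log(te_k))^{−p}` and of `A/(c·p(te_k))` -/

section Inner

/-- the interval of the small-argument branch, `{s : 0 < s, s·e_k < 1}`, is open. [cite: BalabanImbrieJaffe1988, (5.14.4) p.309] -/
theorem isOpen_branch (ek : ℝ) : IsOpen {s : ℝ | 0 < s ∧ s * ek < 1} :=
  (isOpen_lt continuous_const continuous_id).inter (isOpen_lt (continuous_id.mul continuous_const) continuous_const)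

/-- `d/dt (−log(te_k)) = −1/t` for `0 < t`, `0 < e_k`. [cite: BalabanImbrieJaffe1988, (5.14.4) p.309] -/
theorem hasDerivAt_negLog {t ek : ℝ} (ht : 0 < t) (hek : 0 < ek) :
    HasDerivAt (fun s => -Real.log (s * ek)) (-t⁻¹) t := by
  have hm : HasDerivAt (fun s => s * ek) ek t := by simpa using (hasDerivAt_id t).mul_const ek
  have h := (hm.log (mul_pos ht hek).ne').neg
  refine h.congr_deriv ?_
  rw [mul_comm t ek, ← div_div, div_self hek.ne', one_div]

/-- **Structure of the t-derivatives of the inner scale**: for every real `p` and every order `i` there is a finite family of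
coefficients `a_m` and natural exponents `j_m` (depending on `p`, `i` only) with
`(d/dt)^i (−log(te_k))^{−p} = t^{−i} Σ_m a_m (−log(te_k))^{−p−j_m}` for all `0 < e_k`, `0 < t`, `te_k < 1`
(each `d/dt` acting on `t^{−i}(−log(te_k))^{−p−j}` produces `−i·t^{−i−1}(−log(te_k))^{−p−j} + (p+j)·t^{−i−1}(−log(te_k))^{−p−j−1}`).
[cite: BalabanImbrieJaffe1988, (5.14.4) p.309] -/
theorem iteratedDeriv_negLogRpow (p : ℝ) (i : ℕ) :
    ∃ (ι : Type) (_ : Fintype ι) (coef : ι → ℝ) (ex : ι → ℕ),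
      ∀ ⦃ek t : ℝ⦄, 0 < ek → 0 < t → t * ek < 1 →
        iteratedDeriv i (fun s => (-Real.log (s * ek)) ^ (-p)) t =
          t ^ (-(i : ℤ)) * ∑ m, coef m * (-Real.log (t * ek)) ^ (-p - (ex m : ℝ)) := by
  induction i with
  | zero =>
    refine ⟨Unit, inferInstance, fun _ => 1, fun _ => 0, ?_⟩
    intro ek t _ _ _
    simp
  | succ i ih =>
    obtain ⟨ι, _, coef, ex, h⟩ := ih
    refine ⟨ι ⊕ ι, inferInstance, Sum.elim (fun m => -(i : ℝ) * coef m) (fun m => (p + ex m) * coef m),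
      Sum.elim ex (fun m => ex m + 1), ?_⟩
    intro ek t hek ht h1
    have htek : 0 < t * ek := mul_pos ht hek
    have hL : 0 < -Real.log (t * ek) := by have := Real.log_neg htek h1; linarith
    -- the i-th derivative agrees near t with the closed form G
    have hev : iteratedDeriv i (fun s => (-Real.log (s * ek)) ^ (-p)) =ᶠ[𝓝 t]
        fun s => s ^ (-(i : ℤ)) * ∑ m, coef m * (-Real.log (s * ek)) ^ (-p - (ex m : ℝ)) := by
      filter_upwards [(isOpen_branch ek).mem_nhds ⟨ht, h1⟩] with s hs
      exact h hek hs.1 hs.2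
    rw [iteratedDeriv_succ, hev.deriv_eq]
    -- differentiate the closed form
    have hz : HasDerivAt (fun s : ℝ => s ^ (-(i : ℤ))) (((-(i : ℤ) : ℤ) : ℝ) * t ^ (-(i : ℤ) - 1)) t :=
      hasDerivAt_zpow (-(i : ℤ)) t (Or.inl ht.ne')
    have hS := hasDerivAt_negLog ht hek
    have hterm : ∀ m, HasDerivAt (fun s => coef m * (-Real.log (s * ek)) ^ (-p - (ex m : ℝ)))
        (coef m * (-t⁻¹ * (-p - (ex m : ℝ)) * (-Real.log (t * ek)) ^ (-p - (ex m : ℝ) - 1))) t := fun m =>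
      (hS.rpow_const (p := -p - (ex m : ℝ)) (Or.inl hL.ne')).const_mul (coef m)
    have hsum : HasDerivAt (fun s => ∑ m, coef m * (-Real.log (s * ek)) ^ (-p - (ex m : ℝ)))
        (∑ m, coef m * (-t⁻¹ * (-p - (ex m : ℝ)) * (-Real.log (t * ek)) ^ (-p - (ex m : ℝ) - 1))) t :=
      HasDerivAt.fun_sum fun m _ => hterm m
    have hprod := hz.fun_mul hsum
    rw [hprod.deriv]
    -- bookkeeping: exponents and the sum over ι ⊕ ι
    have hz1 : t ^ (-(i : ℤ) - 1) = t ^ (-((i + 1 : ℕ) : ℤ)) := by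
      congr 1; push_cast; ring
    have hz2 : t ^ (-(i : ℤ)) * t⁻¹ = t ^ (-((i + 1 : ℕ) : ℤ)) := by
      rw [← zpow_sub_one₀ ht.ne', hz1]
    have hex : ∀ m, (-Real.log (t * ek)) ^ (-p - (ex m : ℝ) - 1) = (-Real.log (t * ek)) ^ (-p - ((ex m + 1 : ℕ) : ℝ)) := by
      intro m; congr 1; push_cast; ring
    simp only [Fintype.sum_sum_type, Sum.elim_inl, Sum.elim_inr]
    rw [mul_add, hz1]
    congr 1
    · rw [Int.cast_neg, Int.cast_natCast, mul_assoc, Finset.mul_sum, Finset.mul_sum, Finset.mul_sum]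
      exact Finset.sum_congr rfl fun m _ => by ring
    · rw [Finset.mul_sum, Finset.mul_sum]
      refine Finset.sum_congr rfl fun m _ => ?_
      rw [← hex m, ← hz2]
      ring

/-- **`|(d/dt)^i (−log(te_k))^{−p}| ≤ M_i·t^{−i}·(−log(te_k))^{−p}`** for `te_k ≤ e^{−1}` (so `−log(te_k) ≥ 1` and every extra negative power of
`−log(te_k)` is `≤ 1`), with `M_i = M_i(p) ≥ 0` independent of `e_k`, `t`. [cite: BalabanImbrieJaffe1988, (5.14.4) p.309] -/
theorem exists_bound_iteratedDeriv_negLogRpow (p : ℝ) (i : ℕ) :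
    ∃ M : ℝ, 0 ≤ M ∧ ∀ ⦃ek t : ℝ⦄, 0 < ek → 0 < t → t * ek ≤ Real.exp (-1) →
      |iteratedDeriv i (fun s => (-Real.log (s * ek)) ^ (-p)) t| ≤ M * t ^ (-(i : ℤ)) * (-Real.log (t * ek)) ^ (-p) := by
  obtain ⟨ι, _, coef, ex, h⟩ := iteratedDeriv_negLogRpow p i
  refine ⟨∑ m, |coef m|, Finset.sum_nonneg fun m _ => abs_nonneg _, ?_⟩
  intro ek t hek ht h1
  have htek : 0 < t * ek := mul_pos ht hek
  have h1' : t * ek < 1 := h1.trans_lt (by rw [← Real.exp_zero]; exact Real.exp_lt_exp.mpr (by norm_num))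
  have hL1 : 1 ≤ -Real.log (t * ek) := by
    have := Real.log_le_log htek h1
    rw [Real.log_exp] at this
    linarith
  have htz : 0 < t ^ (-(i : ℤ)) := zpow_pos ht _
  rw [h hek ht h1', abs_mul, abs_of_pos htz, mul_comm (∑ m, |coef m|) _, mul_assoc]
  refine mul_le_mul_of_nonneg_left ?_ htz.le
  refine (Finset.abs_sum_le_sum_abs _ _).trans ?_
  rw [Finset.sum_mul]
  refine Finset.sum_le_sum fun m _ => ?_
  rw [abs_mul, abs_of_pos (Real.rpow_pos_of_pos (by linarith) _)]
  refine mul_le_mul_of_nonneg_left ?_ (abs_nonneg _)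
  exact Real.rpow_le_rpow_of_exponent_le hL1 (by have := (ex m).cast_nonneg (α := ℝ); linarith)

/-- On the branch `0 < s`, `s·e_k < 1` the inner function of p. 309 is `A/(c·p(se_k)) = (A/c)·(−log(se_k))^{−p}`.
[cite: BalabanImbrieJaffe1988, (5.14.4) p.309] -/
theorem inner_eq (p A c : ℝ) {ek s : ℝ} (hek : 0 < ek) (hs : 0 < s) (h1 : s * ek < 1) :
    A / (c * pLog p (s * ek)) = A / c * (-Real.log (s * ek)) ^ (-p) := by
  have hL : 0 < -Real.log (s * ek) := by have := Real.log_neg (mul_pos hs hek) h1; linarith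
  rw [pLog_eq_rpow_neg_log p (mul_pos hs hek) h1, Real.rpow_neg hL.le, div_mul_eq_div_div, div_eq_mul_inv]

/-- The inner function is smooth on the branch. [cite: BalabanImbrieJaffe1988, (5.14.4) p.309] -/
theorem contDiffOn_inner (p A c : ℝ) {ek : ℝ} (hek : 0 < ek) (n : ℕ) :
    ContDiffOn ℝ n (fun s => A / (c * pLog p (s * ek))) {s : ℝ | 0 < s ∧ s * ek < 1} := by
  have hlog : ContDiffOn ℝ n (fun s => -Real.log (s * ek)) {s : ℝ | 0 < s ∧ s * ek < 1} :=
    ((contDiffOn_id.mul contDiffOn_const).log fun s hs => (mul_pos hs.1 hek).ne').neg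
  have hpos : ∀ s ∈ {s : ℝ | 0 < s ∧ s * ek < 1}, -Real.log (s * ek) ≠ 0 := fun s hs => by
    have := Real.log_neg (mul_pos hs.1 hek) hs.2; linarith
  have h2 : ContDiffOn ℝ n (fun s => A / c * (-Real.log (s * ek)) ^ (-p)) {s : ℝ | 0 < s ∧ s * ek < 1} :=
    contDiffOn_const.mul (hlog.rpow_const_of_ne hpos)
  exact h2.congr fun s hs => inner_eq p A c hek hs.1 hs.2

/-- **`|(d/dt)^i [A/(c·p(te_k))]| ≤ M_i·t^{−i}·|A/(c·p(te_k))|`** for `te_k ≤ e^{−1}`, `c ≠ 0`, with the constant `M_i(p)` of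
`exists_bound_iteratedDeriv_negLogRpow` (uniform in `A`, `c`, `e_k`). [cite: BalabanImbrieJaffe1988, (5.14.4) p.309] -/
theorem abs_iteratedDeriv_inner_le (p : ℝ) (i : ℕ) {M : ℝ}
    (hM : ∀ ⦃ek t : ℝ⦄, 0 < ek → 0 < t → t * ek ≤ Real.exp (-1) →
      |iteratedDeriv i (fun s => (-Real.log (s * ek)) ^ (-p)) t| ≤ M * t ^ (-(i : ℤ)) * (-Real.log (t * ek)) ^ (-p))
    (A : ℝ) {c ek t : ℝ} (hek : 0 < ek) (ht : 0 < t) (h1 : t * ek ≤ Real.exp (-1)) :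
    |iteratedDeriv i (fun s => A / (c * pLog p (s * ek))) t| ≤ M * t ^ (-(i : ℤ)) * |A / (c * pLog p (t * ek))| := by
  have htek : 0 < t * ek := mul_pos ht hek
  have h1' : t * ek < 1 := h1.trans_lt (by rw [← Real.exp_zero]; exact Real.exp_lt_exp.mpr (by norm_num))
  have hL : 0 < -Real.log (t * ek) := by have := Real.log_neg htek h1'; linarith
  have hev : (fun s => A / (c * pLog p (s * ek))) =ᶠ[𝓝 t] fun s => A / c * (-Real.log (s * ek)) ^ (-p) := by
    filter_upwards [(isOpen_branch ek).mem_nhds ⟨ht, h1'⟩] with s hs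
    exact inner_eq p A c hek hs.1 hs.2
  rw [hev.iteratedDeriv_eq, inner_eq p A c hek ht h1']
  have hcm := iteratedDeriv_const_mul_field (x := t) (n := i) (A / c) (fun s => (-Real.log (s * ek)) ^ (-p))
  rw [hcm, abs_mul, abs_mul, abs_of_pos (Real.rpow_pos_of_pos hL _)]
  calc |A / c| * |iteratedDeriv i (fun s => (-Real.log (s * ek)) ^ (-p)) t|
      ≤ |A / c| * (M * t ^ (-(i : ℤ)) * (-Real.log (t * ek)) ^ (-p)) :=
        mul_le_mul_of_nonneg_left (hM hek ht h1) (abs_nonneg _)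
    _ = M * t ^ (-(i : ℤ)) * (|A / c| * (-Real.log (t * ek)) ^ (-p)) := by ring

end Inner

/-! ## §2 The outer function: uniform bounds on the derivatives of χ(1,·), local constancy off the shell -/

section Outer

variable (χ : CutoffProfile)

/-- From (5.2.3) (*"|dⁿχ(1,x)/dxⁿ| ≤ cⁿn^{cn} for all n, x"*): one constant bounding all derivatives of χ(1,·) of order ≤ n, everywhere.
[cite: BalabanImbrieJaffe1988, (5.2.3) p.278] -/
theorem exists_uniform_deriv_bound (n : ℕ) : ∃ C : ℝ, 0 ≤ C ∧ ∀ i, i ≤ n → ∀ y, |iteratedDeriv i χ.χ₁ y| ≤ C := by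
  obtain ⟨c, hc⟩ := χ.deriv_bound
  have hnn : ∀ j : ℕ, 0 ≤ c ^ j * (j : ℝ) ^ (c * j) := fun j => (abs_nonneg _).trans (hc j 0)
  refine ⟨∑ j ∈ Finset.range (n + 1), c ^ j * (j : ℝ) ^ (c * j), Finset.sum_nonneg fun j _ => hnn j, fun i hi y => ?_⟩
  exact (hc i y).trans (Finset.single_le_sum (fun j _ => hnn j) (Finset.mem_range.mpr (Nat.lt_succ_of_le hi)))

/-- χ(1,·) is `Cⁿ` for every finite `n` (from *"C^∞"* in (5.2.3)). [cite: BalabanImbrieJaffe1988, (5.2.3) p.278] -/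
theorem contDiff_chi1 (n : ℕ) : ContDiff ℝ n χ.χ₁ :=
  χ.smooth.of_le (by exact_mod_cast le_top)

/-- Off the shell, above: if `|A/(c·p(te_k))| > 1` then `s ↦ χ(c·p(se_k), A)` vanishes near `t`, so all its t-derivatives vanish at `t`.
[cite: BalabanImbrieJaffe1988, (5.14.4) p.309] -/
theorem iteratedDeriv_cutoff_t_eq_zero_of_gt (p : ℝ) (n : ℕ) (A : ℝ) {c ek t : ℝ} (hek : 0 < ek) (ht : 0 < t) (h1 : t * ek < 1)
    (hgt : 1 < |A / (c * pLog p (t * ek))|) :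
    iteratedDeriv n (fun s => cutoff χ (c * pLog p (s * ek)) A) t = 0 := by
  have hcont : ContinuousAt (fun s => A / (c * pLog p (s * ek))) t :=
    (contDiffOn_inner p A c hek 0).continuousOn.continuousAt ((isOpen_branch ek).mem_nhds ⟨ht, h1⟩)
  have hev : (fun s => cutoff χ (c * pLog p (s * ek)) A) =ᶠ[𝓝 t] fun _ => (0 : ℝ) := by
    filter_upwards [(continuous_abs.continuousAt.comp hcont).eventually_const_lt hgt] with s hs
    exact χ.eq_zero _ hs.le
  rw [hev.iteratedDeriv_eq, iteratedDeriv_const]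
  simp

/-- Off the shell, below: if `|A/(c·p(te_k))| < 9/10` then `s ↦ χ(c·p(se_k), A)` equals `1` near `t`, so its t-derivatives of order
`n ≥ 1` vanish at `t`. [cite: BalabanImbrieJaffe1988, (5.14.4) p.309] -/
theorem iteratedDeriv_cutoff_t_eq_zero_of_lt (p : ℝ) {n : ℕ} (hn : 1 ≤ n) (A : ℝ) {c ek t : ℝ} (hek : 0 < ek) (ht : 0 < t)
    (h1 : t * ek < 1) (hlt : |A / (c * pLog p (t * ek))| < 9 / 10) :
    iteratedDeriv n (fun s => cutoff χ (c * pLog p (s * ek)) A) t = 0 := by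
  have hcont : ContinuousAt (fun s => A / (c * pLog p (s * ek))) t :=
    (contDiffOn_inner p A c hek 0).continuousOn.continuousAt ((isOpen_branch ek).mem_nhds ⟨ht, h1⟩)
  have hev : (fun s => cutoff χ (c * pLog p (s * ek)) A) =ᶠ[𝓝 t] fun _ => (1 : ℝ) := by
    filter_upwards [(continuous_abs.continuousAt.comp hcont).eventually_lt_const hlt] with s hs
    exact χ.eq_one _ hs.le
  rw [hev.iteratedDeriv_eq, iteratedDeriv_const]
  have : n ≠ 0 := by omega
  simp [this]

end Outer

/-! ## §3 The printed sentence: `|(d/dt)^n χ(cp(te_k), A)| ≤ C t^{−n}`, supported in the shell -/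

section Main

variable (χ : CutoffProfile)

/-- **p. 309, the n-th derivative bound**: for every profile χ of (5.2.3), exponent `p` of (2.33) and order `n` there is `C = C(χ,p,n) ≥ 0`
such that for all real `A`, `c ≠ 0`, `0 < e_k`, `0 < t` with `te_k ≤ e^{−1}`:
`|(d/dt)^n χ(c·p(te_k), A)| ≤ C·t^{−n}`.  MECHANISM (Faà di Bruno): `C = n!·C_χ·D₀ⁿ` with `C_χ` bounding the first `n` derivatives of
χ(1,·) and `D₀ = 1 + Σ_{i≤n} M_i(p)` bounding `t^i·|(d/dt)^i[A/(c·p(te_k))]|` on `|A/(c·p(te_k))| ≤ 1`; where `|A/(c·p(te_k))| > 1` the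
composite vanishes identically near `t`. [cite: BalabanImbrieJaffe1988, (5.14.4) p.309] -/
theorem exists_abs_iteratedDeriv_cutoff_t_le (p : ℝ) (n : ℕ) :
    ∃ C : ℝ, 0 ≤ C ∧ ∀ (A : ℝ) ⦃c ek t : ℝ⦄, c ≠ 0 → 0 < ek → 0 < t → t * ek ≤ Real.exp (-1) →
      |iteratedDeriv n (fun s => cutoff χ (c * pLog p (s * ek)) A) t| ≤ C * t ^ (-(n : ℤ)) := by
  -- constants: M_i for the inner derivatives, C_χ for the outer ones
  choose M hM0 hM using fun i => exists_bound_iteratedDeriv_negLogRpow p i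
  obtain ⟨Cχ, hCχ0, hCχ⟩ := exists_uniform_deriv_bound χ n
  set D₀ : ℝ := 1 + ∑ i ∈ Finset.range (n + 1), M i with hD₀
  have hD₀1 : 1 ≤ D₀ := by
    have : 0 ≤ ∑ i ∈ Finset.range (n + 1), M i := Finset.sum_nonneg fun i _ => hM0 i
    linarith
  have hMD : ∀ i, i ≤ n → M i ≤ D₀ := fun i hi => by
    have := Finset.single_le_sum (fun j _ => hM0 j) (Finset.mem_range.mpr (Nat.lt_succ_of_le hi))
    linarith
  refine ⟨n ! * Cχ * D₀ ^ n, by positivity, ?_⟩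
  intro A c ek t hc hek ht h1
  have htek : 0 < t * ek := mul_pos ht hek
  have h1' : t * ek < 1 := h1.trans_lt (by rw [← Real.exp_zero]; exact Real.exp_lt_exp.mpr (by norm_num))
  have htz : 0 < t ^ (-(n : ℤ)) := zpow_pos ht _
  by_cases hv : |A / (c * pLog p (t * ek))| ≤ 1
  · -- Faà di Bruno on the branch
    have hD : ∀ i, 1 ≤ i → i ≤ n → ‖iteratedDeriv i (fun s => A / (c * pLog p (s * ek))) t‖ ≤ (D₀ / t) ^ i := by
      intro i hi1 hi
      rw [Real.norm_eq_abs]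
      refine (abs_iteratedDeriv_inner_le p i (hM i) A hek ht h1).trans ?_
      rw [div_pow, div_eq_mul_inv, zpow_neg, zpow_natCast]
      have hti : 0 < (t ^ i)⁻¹ := inv_pos.mpr (pow_pos ht _)
      calc M i * (t ^ i)⁻¹ * |A / (c * pLog p (t * ek))|
          ≤ M i * (t ^ i)⁻¹ * 1 := mul_le_mul_of_nonneg_left hv (mul_nonneg (hM0 i) hti.le)
        _ ≤ D₀ ^ i * (t ^ i)⁻¹ := by
            rw [mul_one]
            exact mul_le_mul_of_nonneg_right ((hMD i hi).trans (le_self_pow₀ hD₀1 (by omega))) hti.le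
    have hC' : ∀ i, i ≤ n → ‖iteratedDeriv i χ.χ₁ (A / (c * pLog p (t * ek)))‖ ≤ Cχ := fun i hi => by
      rw [Real.norm_eq_abs]; exact hCχ i hi _
    have key := Literature.Analysis.Calculus.norm_iteratedDeriv_comp_le_of_contDiffOn (isOpen_branch ek) ⟨ht, h1'⟩
      (contDiff_chi1 χ n) (contDiffOn_inner p A c hek n) hC' hD
    have hcomp : (fun s => cutoff χ (c * pLog p (s * ek)) A) = χ.χ₁ ∘ fun s => A / (c * pLog p (s * ek)) := by
      funext s; rfl
    rw [hcomp, ← Real.norm_eq_abs]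
    refine key.trans (le_of_eq ?_)
    rw [div_pow, zpow_neg, zpow_natCast, div_eq_mul_inv]
    ring
  · rw [iteratedDeriv_cutoff_t_eq_zero_of_gt χ p n A hek ht h1' (not_le.mp hv), abs_zero]
    positivity

/-- **p. 309, the support clause** (*"supported in c₁p(te_k) ≤ |A^{(k)}| ≤ c₂p(te_k)"*): for `n ≥ 1` the n-th t-derivative of
`χ(c·p(te_k), A)` vanishes unless `(9/10)|c|·p(te_k) ≤ |A| ≤ |c|·p(te_k)`. [cite: BalabanImbrieJaffe1988, (5.14.4) p.309] -/
theorem support_iteratedDeriv_cutoff_t (p : ℝ) {n : ℕ} (hn : 1 ≤ n) {A c ek t : ℝ} (hc : c ≠ 0) (hek : 0 < ek) (ht : 0 < t)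
    (h1 : t * ek < 1) (hne : iteratedDeriv n (fun s => cutoff χ (c * pLog p (s * ek)) A) t ≠ 0) :
    9 / 10 * (|c| * pLog p (t * ek)) ≤ |A| ∧ |A| ≤ |c| * pLog p (t * ek) := by
  have htek : 0 < t * ek := mul_pos ht hek
  have hL : 0 < -Real.log (t * ek) := by have := Real.log_neg htek h1; linarith
  have hP : 0 < pLog p (t * ek) := by rw [pLog_eq_rpow_neg_log p htek h1]; exact Real.rpow_pos_of_pos hL p
  have hcP : 0 < |c| * pLog p (t * ek) := mul_pos (abs_pos.mpr hc) hP
  have hlo : 9 / 10 ≤ |A / (c * pLog p (t * ek))| := by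
    by_contra h
    exact hne (iteratedDeriv_cutoff_t_eq_zero_of_lt χ p hn A hek ht h1 (not_le.mp h))
  have hhi : |A / (c * pLog p (t * ek))| ≤ 1 := by
    by_contra h
    exact hne (iteratedDeriv_cutoff_t_eq_zero_of_gt χ p n A hek ht h1 (not_le.mp h))
  rw [abs_div, abs_mul, abs_of_pos hP] at hlo hhi
  exact ⟨by rwa [le_div_iff₀ hcP] at hlo, by rwa [div_le_iff₀ hcP, one_mul] at hhi⟩

/-- **The printed sentence in one line** (p. 309: *"the n-th derivative in t of χ(cp(e_k), A^{(k)}) [sic; = χ(cp(te_k), A^{(k)})] is bounded by t^{−n}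
times a function bounded by a constant and supported in c₁p(te_k) ≤ |A^{(k)}| ≤ c₂p(te_k)"*): for `n ≥ 1` there is `C = C(χ,p,n) ≥ 0` with
`|(d/dt)^n χ(c·p(te_k), A)| ≤ t^{−n} · C · 𝟙_{[(9/10)|c|p(te_k), |c|p(te_k)]}(|A|)` for all real `A`, `c ≠ 0`, `0 < e_k`, `0 < t`, `te_k ≤ e^{−1}`.
[cite: BalabanImbrieJaffe1988, (5.14.4) p.309] -/
theorem exists_abs_iteratedDeriv_cutoff_t_le_indicator (p : ℝ) {n : ℕ} (hn : 1 ≤ n) :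
    ∃ C : ℝ, 0 ≤ C ∧ ∀ (A : ℝ) ⦃c ek t : ℝ⦄, c ≠ 0 → 0 < ek → 0 < t → t * ek ≤ Real.exp (-1) →
      |iteratedDeriv n (fun s => cutoff χ (c * pLog p (s * ek)) A) t| ≤
        t ^ (-(n : ℤ)) * (C * Set.indicator (Set.Icc (9 / 10 * (|c| * pLog p (t * ek))) (|c| * pLog p (t * ek)))
          (fun _ => (1 : ℝ)) |A|) := by
  obtain ⟨C, hC0, hC⟩ := exists_abs_iteratedDeriv_cutoff_t_le χ p n
  refine ⟨C, hC0, fun A c ek t hc hek ht h1 => ?_⟩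
  have h1' : t * ek < 1 := h1.trans_lt (by rw [← Real.exp_zero]; exact Real.exp_lt_exp.mpr (by norm_num))
  by_cases hA : |A| ∈ Set.Icc (9 / 10 * (|c| * pLog p (t * ek))) (|c| * pLog p (t * ek))
  · rw [Set.indicator_of_mem hA, mul_one, mul_comm]
    exact hC A hc hek ht h1
  · rw [Set.indicator_of_notMem hA, mul_zero, mul_zero]
    have hzero : iteratedDeriv n (fun s => cutoff χ (c * pLog p (s * ek)) A) t = 0 := by
      by_contra hne
      exact hA (support_iteratedDeriv_cutoff_t χ p hn hc hek ht h1' hne)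
    rw [hzero, abs_zero]

end Main

end Literature.MathematicalPhysics.QuantumFieldTheory.BalabanImbrieJaffe1984to88.BIJ88ChiTDerivN309
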